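import Literature.NumberTheory.Transcendental.KZProductIdeal
import Summits.KontsevichZagierPeriods.KontsevichZagierPeriods.Theorems.ValuedFieldSpecialisationClassLevelExpansionFibreDimOneToolkit
import Summits.KontsevichZagierPeriods.KontsevichZagierPeriods.Theorems.ValuedFieldSpecialisationClassLevelExpansionFibreDimOneElementaryA

/-!
# Route ValuedFieldSpecialisation — calibration of the elementary divergent products:
# the padding coordinate `u` is removed by fibred moves

Helper for item stmt-KontsevichZagierPeriods-3503 (`ClassLevelExpansionFibreDimOne`). The
elementary divergent product families of the item carry a PADDING coordinate `u` (coordinate `1`,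
right after the parameter `s = z 0`) ranging over `0 < u`, `u ^ q * s ^ p < 1`, on which the
integrand does not depend; its only role is to produce the factor `∫ du = s ^ (-p/q)` in the
slice values while keeping the integrand a product of fibre data. This file checks that the
encoding is compatible with the FIBRED calculus: for every `ℚ`-semialgebraic base `B ⊆ {0 < v 0}`
and `ℚ`-semialgebraic `g` on `B`,

  `[ {z | z∘δ ∈ B, 0 < z 1, (z 1)^q (z 0)^p < 1}, g (z∘δ) ] − [ B, (v 0)^(-p/q) · g v ]`
  `∈ KZ.fibredRelations`                                    (`δ = Fin.succAbove 1` skips `u`)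

(`of_padded_sub_of_mem_fibredRelations`): relabel the coordinates so that `u` comes last (a
coordinate permutation fixing `0` is a fibred change of variables,
`of_sub_of_reindex_mem_fibredRelations`), close the `u`-fibres `(0, s^(-p/q))` to
`[0, s^(-p/q)]` (a null set, a fibred move) and integrate `u` out by ONE fibred Newton–Leibniz
move with the primitive `u · g` (`s ↦ s^(-p/q)` is `ℚ`-semialgebraic on `{0 < s}`: its graph is
`{0 < t, t^q s^p = 1}`).

Sources: M. Kontsevich, D. Zagier, *Periods* (2001), §1.2, rules (1)–(3); the fibred calculus and
the elementary products are this route's. Deliberately NOT here: existence (integrability) of the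
padded representations, and anything about the `y`-coordinates `s ≤ y_j ≤ 1` of the elementary
products (they are untouched by these moves).
-/

noncomputable section

namespace Summit.KontsevichZagierPeriods.ValuedFieldSpecialisation

open MeasureTheory Set Filter MvPolynomial
open scoped Topology
open Literature.NumberTheory.Transcendental Literature.NumberTheory.Transcendental.KZ
open Literature.ModelTheory.ExponentialFields (IsSemialgebraic isSemialgebraic_setOf_eval_pos
  isSemialgebraic_setOf_eval_eq_zero)

variable {n : ℕ}

/-! ### Coordinate permutations fixing the parameter are fibred moves -/

/-- **Relabelling the fibre coordinates is a fibred change of variables**: for a coordinate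
relabelling `e : Fin (n + 1) ≃ Fin (k + 1)` (so `k = n`) with `e 0 = 0`,
`[r] − [r.reindex e] ∈ fibredRelations`. The map
`Φ z = z ∘ e⁻¹` is linear (its own derivative), injective, a `ℚ`-polynomial map with
`|det Φ| = 1` (a permutation matrix), `Φ '' σ = {w | w ∘ e ∈ σ}`, and `Φ z 0 = z (e⁻¹ 0) = z 0`.
(The unfibred statement is `KZ.of_sub_of_reindex_mem_relations`.)
[Kontsevich–Zagier 2001, §1.2, rule (2)] [folklore] -/
theorem of_sub_of_reindex_mem_fibredRelations {k : ℕ} (r : IntegralRep (n + 1))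
    (e : Fin (n + 1) ≃ Fin (k + 1)) (he : e 0 = 0) :
    of r - of (r.reindex e) ∈ fibredRelations := by
  obtain rfl : n = k := by simpa using Fintype.card_congr e
  -- the linear map `z ↦ z ∘ e.symm` as a matrix
  let M : Matrix (Fin (n + 1)) (Fin (n + 1)) ℝ :=
    (1 : Matrix (Fin (n + 1)) (Fin (n + 1)) ℝ).submatrix e.symm (Equiv.refl _)
  let L : (Fin (n + 1) → ℝ) →L[ℝ] (Fin (n + 1) → ℝ) :=
    LinearMap.toContinuousLinearMap (Matrix.toLin' M)
  have hL : ∀ z : Fin (n + 1) → ℝ, L z = fun j => z (e.symm j) := by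
    intro z
    change Matrix.toLin' M z = _
    rw [Matrix.toLin'_apply, Matrix.submatrix_mulVec_equiv, Matrix.one_mulVec]
    rfl
  have hdet : |L.det| = 1 := by
    change |LinearMap.det (Matrix.toLin' M)| = 1
    rw [LinearMap.det_toLin', Matrix.abs_det_submatrix_equiv_equiv, Matrix.det_one, abs_one]
  have he' : e.symm 0 = 0 := by rw [Equiv.symm_apply_eq]; exact he.symm
  refine mem_fibredRelations_of_mem_fibredChangeOfVariablesRel
    ⟨n, r, r.reindex e, fun z => fun j => z (e.symm j), fun _ => L, ?_, ?_, ?_, ?_, ?_, ?_, rfl⟩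
  · -- semialgebraic: a coordinate (polynomial) map
    convert isSemialgebraicMapOn_aeval r.isSemialgebraic_domain
      (fun j => (X (e.symm j) : MvPolynomial (Fin (n + 1)) ℚ)) using 2 with z
    ext j; simp
  · intro z _
    have h := L.hasFDerivWithinAt (s := r.domain) (x := z)
    convert h using 1
    ext z' j
    rw [hL]
  · intro z₁ _ z₂ _ h
    ext i
    have := congrFun h (e i)
    simpa using this
  · ext w
    simp only [IntegralRep.reindex_domain, mem_setOf_eq, mem_image]
    constructor
    · intro hw
      exact ⟨fun i => w (e i), hw, by ext j; simp⟩
    · rintro ⟨z, hz, rfl⟩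
      simpa using hz
  · intro z _
    rw [hdet, mul_one, IntegralRep.reindex_integrand]
    simp
  · intro z _
    simp [he']

/-! ### The rational power `s ↦ s ^ (-p/q)` -/

/-- For `0 < s` and `0 < q`: `t = s ^ (-p/q)` iff `0 < t` and `t ^ q * s ^ p = 1` (positive `q`-th
roots are unique). [folklore] -/
theorem eq_rpow_neg_div_iff {s t : ℝ} (hs : 0 < s) {p q : ℕ} (hq : 0 < q) :
    t = s ^ (-(p : ℝ) / q) ↔ 0 < t ∧ t ^ q * s ^ p = 1 := by
  have hq0 : (q : ℝ) ≠ 0 := by exact_mod_cast hq.ne'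
  have key : (s ^ (-(p : ℝ) / q)) ^ q * s ^ p = 1 := by
    rw [← Real.rpow_natCast (s ^ (-(p : ℝ) / q)) q, ← Real.rpow_mul hs.le,
      div_mul_cancel₀ _ hq0, Real.rpow_neg hs.le, Real.rpow_natCast,
      inv_mul_cancel₀ (pow_ne_zero _ hs.ne')]
  constructor
  · rintro rfl
    exact ⟨Real.rpow_pos_of_pos hs _, key⟩
  · rintro ⟨ht, h⟩
    have hsp : 0 < s ^ p := pow_pos hs p
    have h1 : t ^ q = (s ^ (-(p : ℝ) / q)) ^ q :=
      mul_right_cancel₀ hsp.ne' (h.trans key.symm)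
    exact (pow_left_inj₀ ht.le (Real.rpow_nonneg hs.le _) hq.ne').mp h1

/-- **`v ↦ (v 0) ^ (-p/q)` is `ℚ`-semialgebraic** on any `ℚ`-semialgebraic `B ⊆ {0 < v 0}`: its
graph is `{w | init w ∈ B} ∩ {0 < w last} ∩ {w last ^ q * (w 0) ^ p = 1}`.
[Bochnak–Coste–Roy 1998, §2.2] [folklore] -/
theorem isSemialgebraicFunOn_rpow_zero {B : Set (Fin (n + 1) → ℝ)} (hB : IsSemialgebraic ℚ B)
    (hB0 : ∀ v ∈ B, 0 < v 0) {p q : ℕ} (hq : 0 < q) :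
    IsSemialgebraicFunOn ℚ B (fun v => (v 0) ^ (-(p : ℝ) / q)) := by
  rw [isSemialgebraicFunOn_iff]
  have h1 : IsSemialgebraic ℚ {w : Fin (n + 1 + 1) → ℝ | 0 < w (Fin.last (n + 1))} := by
    simpa using isSemialgebraic_setOf_eval_pos (k := ℚ) (R := ℝ) (X (Fin.last (n + 1)))
  have h2 : IsSemialgebraic ℚ
      {w : Fin (n + 1 + 1) → ℝ | w (Fin.last (n + 1)) ^ q * w 0 ^ p = 1} := by
    have := isSemialgebraic_setOf_eval_eq_zero (k := ℚ) (R := ℝ)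
      ((X (Fin.last (n + 1)) : MvPolynomial (Fin (n + 1 + 1)) ℚ) ^ q * X 0 ^ p - 1)
    convert this using 2 with w
    simp [sub_eq_zero]
  convert (hB.setOf_init_mem.inter h1).inter h2 using 1
  ext w
  simp only [mem_setOf_eq, mem_inter_iff]
  constructor
  · rintro ⟨hw, hlast⟩
    have h0 : (Fin.init w) 0 = w 0 := rfl
    have := (eq_rpow_neg_div_iff (hB0 _ hw) hq).mp hlast
    rw [h0] at this
    exact ⟨⟨hw, this.1⟩, this.2⟩
  · rintro ⟨⟨hw, hpos⟩, heq⟩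
    refine ⟨hw, (eq_rpow_neg_div_iff (hB0 _ hw) hq).mpr ⟨hpos, ?_⟩⟩
    exact heq

/-! ### Removing the padding coordinate -/

/-- The coordinate permutation of `Fin (N + 2)` moving the padding index `1` to the last place
(and shifting `2, …, N + 1` down by one), fixing `0`. [folklore] -/
theorem exists_perm_padding (N : ℕ) :
    ∃ e : Fin (N + 1 + 1) ≃ Fin (N + 1 + 1), e 0 = 0 ∧ e 1 = Fin.last (N + 1) ∧
      ∀ i : Fin (N + 1), e (Fin.succAbove 1 i) = Fin.castSucc i := by
  refine ⟨(finSuccEquiv' (1 : Fin (N + 1 + 1))).trans (finSuccEquiv' (Fin.last (N + 1))).symm,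
    ?_, ?_, fun i => ?_⟩
  · show (finSuccEquiv' (Fin.last (N + 1))).symm (finSuccEquiv' (1 : Fin (N + 1 + 1)) 0) = 0
    have h1 : finSuccEquiv' (1 : Fin (N + 1 + 1)) 0 = some 0 := by
      have := finSuccEquiv'_succAbove (1 : Fin (N + 1 + 1)) 0
      rwa [Fin.one_succAbove_zero] at this
    rw [h1, finSuccEquiv'_symm_some, Fin.succAbove_last, Fin.castSucc_zero]
  · simp
  · simp

/-- **The padding coordinate is removed by fibred moves.** Let `B ⊆ {v | 0 < v 0} ⊆ ℝᴺ⁺¹` and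
`g : ℝᴺ⁺¹ → ℝ` be `ℚ`-semialgebraic, `0 < q`. If `P` is the PADDED representation — domain
`{z | z∘δ ∈ B, 0 < z 1, (z 1)^q (z 0)^p < 1}` (`δ = Fin.succAbove 1` forgets the padding coordinate
`u = z 1`), integrand `g (z∘δ)` on it — and `M` is the representation on `B` with integrand
`(v 0)^(-p/q) · g v` on `B`, then `[P] − [M] ∈ KZ.fibredRelations`: relabel `u` to the last place
(`of_sub_of_reindex_mem_fibredRelations`), close the `u`-fibres `(0, s^(-p/q))` (the added set is
null: a hyperplane and a graph), and integrate `u` out by one fibred Newton–Leibniz move with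
primitive `u · g`, whose evaluation `[u g]₀^{s^(-p/q)}` is `M`'s integrand. This is the
calibration of the padding coordinate of the route's elementary divergent products.
[Kontsevich–Zagier 2001, §1.2, rules (1)–(3)] [folklore] -/
theorem of_padded_sub_of_mem_fibredRelations {N p q : ℕ} (hq : 0 < q)
    {B : Set (Fin (N + 1) → ℝ)} (hB : IsSemialgebraic ℚ B) (hB0 : ∀ v ∈ B, 0 < v 0)
    {g : (Fin (N + 1) → ℝ) → ℝ} (hg : IsSemialgebraicFunOn ℚ B g)
    (P : IntegralRep (N + 1 + 1)) (M : IntegralRep (N + 1))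
    (hPd : P.domain = {z | (fun i => z (Fin.succAbove 1 i)) ∈ B ∧ 0 < z 1 ∧ z 1 ^ q * z 0 ^ p < 1})
    (hPi : ∀ z ∈ P.domain, P.integrand z = g (fun i => z (Fin.succAbove 1 i)))
    (hMd : M.domain = B)
    (hMi : ∀ v ∈ M.domain, M.integrand v = (v 0) ^ (-(p : ℝ) / q) * g v) :
    of P - of M ∈ fibredRelations := by
  subst hMd
  -- notation: `t₀ v = (v 0) ^ (-p/q)`, the upper end of the `u`-fibre
  set t₀ : (Fin (N + 1) → ℝ) → ℝ := fun v => (v 0) ^ (-(p : ℝ) / q) with ht₀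
  have ht₀pos : ∀ v ∈ M.domain, 0 < t₀ v := fun v hv => Real.rpow_pos_of_pos (hB0 v hv) _
  have ht₀key : ∀ v ∈ M.domain, t₀ v ^ q * v 0 ^ p = 1 := fun v hv =>
    ((eq_rpow_neg_div_iff (hB0 v hv) hq).mp rfl).2
  have ht₀sa : IsSemialgebraicFunOn ℚ M.domain t₀ := isSemialgebraicFunOn_rpow_zero hB hB0 hq
  -- `u ≤ t₀` versus `u ^ q * s ^ p ≤ 1` for `0 ≤ u`
  have hcmp : ∀ v ∈ M.domain, ∀ u : ℝ, 0 ≤ u → (u ^ q * v 0 ^ p < 1 → u < t₀ v) ∧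
      (u < t₀ v → u ^ q * v 0 ^ p < 1) := by
    intro v hv u hu
    have hsp : 0 < v 0 ^ p := pow_pos (hB0 v hv) p
    constructor
    · intro h
      by_contra hle
      push Not at hle
      have : t₀ v ^ q ≤ u ^ q := pow_le_pow_left₀ (ht₀pos v hv).le hle q
      have := mul_le_mul_of_nonneg_right this hsp.le
      rw [ht₀key v hv] at this
      linarith
    · intro h
      have : u ^ q < t₀ v ^ q := pow_lt_pow_left₀ h hu hq.ne'
      have := mul_lt_mul_of_pos_right this hsp
      rwa [ht₀key v hv] at this
  -- Step 1: relabel so that the padding coordinate is last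
  obtain ⟨e, he0, he1, heδ⟩ := exists_perm_padding N
  have hinit : ∀ w : Fin (N + 1 + 1) → ℝ, (fun i => w (e (Fin.succAbove 1 i))) = Fin.init w := by
    intro w; funext i; simp [heδ, Fin.init]
  set P₁ := P.reindex e with hP₁
  have h₁ : of P - of P₁ ∈ fibredRelations := of_sub_of_reindex_mem_fibredRelations P e he0
  have hP₁d : ∀ w, w ∈ P₁.domain ↔ Fin.init w ∈ M.domain ∧ 0 < w (Fin.last (N + 1)) ∧
      w (Fin.last (N + 1)) ^ q * w 0 ^ p < 1 := by
    intro w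
    rw [hP₁, IntegralRep.reindex_domain, mem_setOf_eq, hPd, mem_setOf_eq, hinit w]
    simp only [he0, he1]
  have hP₁i : ∀ w ∈ P₁.domain, P₁.integrand w = g (Fin.init w) := by
    intro w hw
    rw [hP₁, IntegralRep.reindex_integrand]
    have hz : (fun i => w (e i)) ∈ P.domain := hw
    simpa only [hinit w] using hPi _ hz
  -- Step 2: the closed band `{init w ∈ B, 0 ≤ u ≤ t₀ (init w)}` with integrand `g ∘ init`
  have hband_sa : IsSemialgebraic ℚ (KZlog.band M.domain (fun _ => 0) t₀) :=
    KZlog.isSemialgebraic_band (by simpa using isSemialgebraicFunOn_ratCast hB 0) ht₀sa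
  have hsub : P₁.domain ⊆ KZlog.band M.domain (fun _ => 0) t₀ := by
    intro w hw
    obtain ⟨hwB, hu, hlt⟩ := (hP₁d w).mp hw
    exact ⟨hwB, hu.le, ((hcmp _ hwB _ hu.le).1 hlt).le⟩
  have hnull : volume (KZlog.band M.domain (fun _ => 0) t₀ \ P₁.domain) = 0 := by
    have hcover : KZlog.band M.domain (fun _ => 0) t₀ \ P₁.domain ⊆
        {w : Fin (N + 1 + 1) → ℝ | w (Fin.last (N + 1)) = 0} ∪
          {w | Fin.init w ∈ M.domain ∧ w (Fin.last (N + 1)) = t₀ (Fin.init w)} := by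
      rintro w ⟨⟨hwB, h0u, hut⟩, hw⟩
      by_cases hu0 : w (Fin.last (N + 1)) = 0
      · exact Or.inl hu0
      · right
        refine ⟨hwB, ?_⟩
        have hupos : 0 < w (Fin.last (N + 1)) := lt_of_le_of_ne h0u (Ne.symm hu0)
        rcases hut.lt_or_eq with hlt | heq
        · exact (hw ((hP₁d w).mpr ⟨hwB, hupos, (hcmp _ hwB _ hupos.le).2 hlt⟩)).elim
        · exact heq
    exact measure_mono_null hcover
      (measure_union_null (volume_setOf_last_eq_zero 0) (volume_graph_eq_zero ht₀sa))
  have hgi : IsSemialgebraicFunOn ℚ (KZlog.band M.domain (fun _ => 0) t₀) (fun w => g (Fin.init w)) :=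
    hg.comp_init_mono hband_sa (fun w hw => hw.1)
  have hgint : IntegrableOn (fun w => g (Fin.init w)) (KZlog.band M.domain (fun _ => 0) t₀) := by
    have hE : IntegrableOn (fun w => g (Fin.init w)) P₁.domain :=
      P₁.integrableOn.congr_fun (fun w hw => hP₁i w hw) (IntegralRep.measurableSet_domain_holds P₁)
    have hZ : IntegrableOn (fun w : Fin (N + 1 + 1) → ℝ => g (Fin.init w))
        (KZlog.band M.domain (fun _ => 0) t₀ \ P₁.domain) := by
      rw [IntegrableOn, Measure.restrict_eq_zero.mpr hnull]
      exact integrable_zero_measure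
    have := hE.union hZ
    rwa [union_sdiff_cancel hsub] at this
  let Rb : IntegralRep (N + 1 + 1) := ⟨_, _, hband_sa, hgi, hgint⟩
  -- Step 3: `[Rb] − [Rb|P₁.domain]` (null complement) and `[Rb|P₁.domain] − [P₁]` (congruence)
  have h₂ : of Rb - of (Rb.restrict P₁.domain P₁.isSemialgebraic_domain hsub) ∈ fibredRelations :=
    of_sub_of_restrict_mem_fibredRelations Rb P₁.isSemialgebraic_domain hsub hnull
  have h₃ : of (Rb.restrict P₁.domain P₁.isSemialgebraic_domain hsub) - of P₁ ∈ fibredRelations :=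
    of_sub_of_mem_fibredRelations_of_eqOn rfl fun w hw => (hP₁i w hw).symm
  -- Step 4: one fibred Newton–Leibniz move along `u`, primitive `u · g`
  have h₄ : of Rb - of M ∈ fibredRelations := by
    refine mem_fibredRelations_of_mem_fibredNewtonLeibnizRel (of_sub_of_mem_fibredNewtonLeibnizRel
      ⟨N + 1, Rb, M, fun _ => 0, t₀, fun w => w (Fin.last (N + 1)) * g (Fin.init w), ?_,
        by simpa using isSemialgebraicFunOn_ratCast hB 0, ht₀sa, fun v hv => (ht₀pos v hv).le,
        rfl, fun v hv => ?_, fun v hv u hu => ?_, fun v hv => ?_, rfl⟩)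
    · exact IsSemialgebraicFunOn.mul_holds (isSemialgebraicFunOn_apply hband_sa (Fin.last _)) hgi
    · simp only [Fin.init_snoc, Fin.snoc_last]
      fun_prop
    · simp only [Fin.init_snoc, Fin.snoc_last]
      show HasDerivAt (fun s : ℝ => s * g v) (g (Fin.init (Fin.snoc v u : Fin (N + 1 + 1) → ℝ))) u
      rw [Fin.init_snoc]
      simpa using (hasDerivAt_id u).mul_const (g v)
    · rw [hMi v hv]
      simp [ht₀]
  -- assembly
  have : of P - of M = (of P - of P₁) -
      (of (Rb.restrict P₁.domain P₁.isSemialgebraic_domain hsub) - of P₁) -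
      (of Rb - of (Rb.restrict P₁.domain P₁.isSemialgebraic_domain hsub)) + (of Rb - of M) := by
    abel
  rw [this]
  exact fibredRelations.add_mem (fibredRelations.sub_mem (fibredRelations.sub_mem h₁ h₃) h₂) h₄

/-! ### Specialisation to the elementary divergent products of the item -/

/-- Forgetting the padding coordinate of `(s, u, y, w)`: `z ∘ δ = (s, y, w)` for
`z = vecCons s (vecCons u x)`, `δ = Fin.succAbove 1`. [folklore] -/
theorem comp_succAbove_one_vecCons_vecCons {N : ℕ} (s u : ℝ) (x : Fin N → ℝ) :
    (fun i => (Matrix.vecCons s (Matrix.vecCons u x) : Fin (N + 1 + 1) → ℝ) (Fin.succAbove 1 i)) =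
      Matrix.vecCons s x := by
  funext i
  refine Fin.cases ?_ (fun k => ?_) i
  · simp
  · simp [Fin.one_succAbove_succ]

/-- **Calibration of the elementary divergent products.** Let `P` be an elementary divergent
product of the item (`p q b d`, `0 < q`, representation `ρ` of dimension `d`; domain
`{(s, u, y, w) | 0 < s < 1, 0 < u, u^q s^p < 1, s ≤ y_j ≤ 1, w ∈ ρ.domain}`, integrand
`∏ y_j⁻¹ · ρ.integrand w`) and `M` a representation on `{(s, y, w) | 0 < s < 1, s ≤ y_j ≤ 1,
w ∈ ρ.domain}` with integrand `s^(-p/q) · ∏ y_j⁻¹ · ρ.integrand w` there. Then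
`[P] − [M] ∈ KZ.fibredRelations` (`of_padded_sub_of_mem_fibredRelations`): the padding coordinate
of the route's encoding is removed by fibred moves, leaving the honest divergent monomial
`s^(-p/q)` as a factor of the integrand. [Kontsevich–Zagier 2001, §1.2, rules (1)–(3)]
[folklore] -/
theorem of_elementary_sub_of_mem_fibredRelations {p q b d : ℕ} (hq : 0 < q) (ρ : IntegralRep d)
    (P : IntegralRep (b + d + 1 + 1)) (M : IntegralRep (b + d + 1))
    (hPd : P.domain = {z | ∃ (s u : ℝ) (y : Fin b → ℝ) (w : Fin d → ℝ),
      z = Matrix.vecCons s (Matrix.vecCons u (Fin.append y w)) ∧ 0 < s ∧ s < 1 ∧ 0 < u ∧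
        u ^ q * s ^ p < 1 ∧ (∀ j, s ≤ y j ∧ y j ≤ 1) ∧ w ∈ ρ.domain})
    (hPi : P.integrand = fun z => (∏ j : Fin b, (z (Fin.castAdd d j).succ.succ)⁻¹) *
      ρ.integrand (fun l : Fin d => z (Fin.natAdd b l).succ.succ))
    (hMd : M.domain = {v | ∃ (s : ℝ) (y : Fin b → ℝ) (w : Fin d → ℝ),
      v = Matrix.vecCons s (Fin.append y w) ∧ 0 < s ∧ s < 1 ∧ (∀ j, s ≤ y j ∧ y j ≤ 1) ∧
        w ∈ ρ.domain})
    (hMi : ∀ v ∈ M.domain, M.integrand v = (v 0) ^ (-(p : ℝ) / q) *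
      ((∏ j : Fin b, (v (Fin.castAdd d j).succ)⁻¹) *
        ρ.integrand (fun l : Fin d => v (Fin.natAdd b l).succ))) :
    of P - of M ∈ fibredRelations := by
  -- facts about the base `M.domain`
  have hB0 : ∀ v ∈ M.domain, 0 < v 0 := by
    intro v hv
    rw [hMd] at hv
    obtain ⟨s, y, w, rfl, hs, -⟩ := hv
    simpa using hs
  have hBy : ∀ v ∈ M.domain, ∀ j : Fin b, 0 < v (Fin.castAdd d j).succ := by
    intro v hv j
    rw [hMd] at hv
    obtain ⟨s, y, w, rfl, hs, -, hy, -⟩ := hv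
    simpa using hs.trans_le (hy j).1
  have hBw : M.domain ⊆ {v | (fun l : Fin d => v (Fin.natAdd b l).succ) ∈ ρ.domain} := by
    intro v hv
    rw [hMd] at hv
    obtain ⟨s, y, w, rfl, -, -, -, hw⟩ := hv
    simpa using hw
  have hg : IsSemialgebraicFunOn ℚ M.domain (fun v => (∏ j : Fin b, (v (Fin.castAdd d j).succ)⁻¹) *
      ρ.integrand (fun l : Fin d => v (Fin.natAdd b l).succ)) := by
    refine IsSemialgebraicFunOn.mul_holds ?_ ?_
    · exact isSemialgebraicFunOn_finset_prod' M.isSemialgebraic_domain Finset.univ _ fun j _ =>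
        (isSemialgebraicFunOn_apply M.isSemialgebraic_domain _).inv fun v hv => (hBy v hv j).ne'
    · exact (isSemialgebraicFunOn_comp_coords ρ.isSemialgebraicFunOn_integrand
        (fun l : Fin d => (Fin.natAdd b l).succ)).mono hBw M.isSemialgebraic_domain
  refine of_padded_sub_of_mem_fibredRelations hq M.isSemialgebraic_domain hB0 hg P M ?_ ?_ rfl hMi
  · -- the two descriptions of the padded domain
    rw [hPd, hMd]
    ext z
    simp only [mem_setOf_eq]
    constructor
    · rintro ⟨s, u, y, w, rfl, hs, hs1, hu, huq, hy, hw⟩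
      refine ⟨⟨s, y, w, comp_succAbove_one_vecCons_vecCons s u _, hs, hs1, hy, hw⟩, ?_, ?_⟩
      · simpa using hu
      · simpa using huq
    · rintro ⟨⟨s, y, w, hz, hs, hs1, hy, hw⟩, hu, huq⟩
      have h0 : z 0 = s := by
        have := congrFun hz 0
        simpa [Fin.one_succAbove_zero] using this
      have h2 : ∀ k : Fin (b + d), z k.succ.succ = Fin.append y w k := by
        intro k
        have := congrFun hz k.succ
        simpa [Fin.one_succAbove_succ] using this
      refine ⟨s, z 1, y, w, ?_, hs, hs1, hu, by simpa [h0] using huq, hy, hw⟩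
      funext i
      refine Fin.cases ?_ (fun i' => Fin.cases ?_ (fun k => ?_) i') i
      · simpa using h0
      · simp
      · simpa using h2 k
  · intro z _
    simp [hPi, Fin.one_succAbove_succ]

end Summit.KontsevichZagierPeriods.ValuedFieldSpecialisation
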